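import Summits.QuantumFields.QCD.Theses.HeatSlicedQuarks
import Summits.QuantumFields.QCD.Theses.GradientFlowSpecies
import Literature.MathematicalPhysics.QuantumFieldTheory.BlockScaleEffectivePerturbation
import Literature.Probability.LatticeModels.GibbsSpecification

/-!
# Line `threshold-irrelevance-squeeze` — skeleton for crux `HeatSlicedQuarks.RobustYangMillsHandover`
(stmt-QuantumFields-8892, `:= ContinuumQCDExists → QCD`), crux-plan round 1.

**Idea** (Cruxes/RobustYangMillsHandover/Ideas/threshold-irrelevance-squeeze.md; triage r1-1/2/3: pass; lever
shared with `geometric-mean-handover`, merged here by the panel). Two freedoms of the statement, multiplied: the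
threshold reading lets every quark be as heavy as we like relative to the pure-gauge scale `Λ′`, and below the quark
scale the heavy-quark remainder of the effective gauge action is, after the coupling shift (CouplingMatching) and a
constant, a sum of dimension-≥ 6 gauge invariants — RG-IRRELEVANT. So the perturbation that "robust Yang–Mills" must
tolerate at the scale where the gap is certified can be SQUEEZED below ANY positive radius by starting the handover
deep enough in the ultraviolet (`stub_engineReentry` at block scale `ℓ = ℓ′·L^{-k₀}`, then `k₀` pure-gauge steps,
`stub_irrelevanceContraction`), and a positive radius is AUTOMATIC for a gap certified by a STRICT finite-size
condition that is continuous in the action (`stub_ymCertificate` = the Yang–Mills input in certificate form, with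
boundary conditions on cubes of cells as the panel demanded; `stub_certificateContinuity` = the card's first lemma in
kernel/ε–δ form, provable now; `stub_certifiedClustering` = the Dobrushin–Shlosman-type criterion on the BLOCK torus
for an arbitrary positive density). `stub_packaging` turns block-scale clustering plus the engine's quark-line
re-entry into the lattice gap clause; the continuum gap clause is paid by the REGISTERED item
`GradientFlowSpecies.GapTransfer` (stmt-QuantumFields-8923, "existence pays the continuum half", triage r1-1/2/3), an
admissible hypothesis of `RobustYangMillsHandover_of`.

**Currency.** Everything is typed over the tree: fine lattice QCD expectations `qcdTorusExpect` / `qcdLatticeConnectedCorr`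
(QCDOS), block fields through the CANONICAL AXIAL FRAME BLOCKING `canonLink N S` (straight transporters between the
corners `⌊jN/S⌋` — `[b,2b)`-frames, so EVERY torus side `2S+1` is served, cf. OneCertifiedCube), blocked Yang–Mills
densities (`IsBlockedYM`, push-forward of `perturbedWilsonDensity ρ β′ 0 · torusLinkHaar`), block-scale tilts
`W : QuasiLocalGaugePerturbation 4 S 𝔾 1` with the tree's norms `NormLE` / `HasAnalyticNormLE` / `HasLargeFieldFloor`,
conditional kernels `densityKernel` (`Specification (Edge 4 S) 𝔾`, `glueWith`) for the finite-size conditions.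
POSITIVITY: the formats assert that the BLOCKED QCD weight is a positive tilt `σ·e^{-W}` of blocked YM (real `W`);
this is the fibre-positivity bet of the sibling card `rao-blackwell-sign` (triage r1-2/3: plausible on the honest
heavy branch), and it is what lets the certificate be of total-variation type (typeable today) instead of the card's
complex-activity KP type (no polymer-expansion infrastructure in the tree) — recorded in the line card.

**SCOPE FINDING (this seat; affects every heavy-threshold line on this crux).** `QCDOf N_f` in its threshold reading
(audit g7, `qcdOf_iff_threshold`) quantifies over ALL tuples above a COMMON offset, hence over UNBOUNDED SPLITTINGS.
The regularisation is mass-independent, so `Λ^{(N_f)}` is fixed and decoupling the heaviest flavour `X` RAISES the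
induced scale, `Λ^{(N_f-1)}(X) = Λ^{b₀(N_f)/b₀(N_f-1)} X^{1-b₀(N_f)/b₀(N_f-1)}` (one loop: exponent `2/31` for
`2 → 1`, `2/29` for `3 → 2`; the split-mass form of CouplingMatching 8797), equivalently
`1/g²(m) = b₀(N_f) log(m²/Λ²) − (1/24π²) log(X²/m²) → −∞`: for tuples `(m,…,m,X)` with `X ≳ Λ(m/Λ)^{(33-2N_f)/2}`
the lighter flavours are LIGHT relative to the induced scale (the chiral regime in ratio, for `N_f − 1` flavours),
no heavy re-entry exists, and the squeeze parameter `(Λ′/m_f)²` diverges. Hence stubs 1–6 prove (sorry-free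
composition `boundedSplitting_of`) exactly the BOUNDED-SPLITTING statement `QCDOfBoundedSplitting N_f`
(`∃ reg, … ∀ σ ≥ 1, ∃ M₀, ∀ m` above `M₀` with all ratios `≤ σ`, the body of `QCDOf`), and the crux is reached only
through `stub_transferExtremeHierarchies : (∀ N_f ∈ {2,3}, QCDOfBoundedSplitting N_f) → ∀ N_f ∈ {2,3}, QCDOf N_f` —
the card's `Transfer` (C⁺ ⇒ crux), which is FALSE-as-claimed on extreme hierarchies and whose honest content is
(N_f−1)-flavour QCD with light quarks. It is registered as the line's transfer stub so that the residue is on the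
ledger; the line card recommends restating the crux to the bounded-splitting conclusion (see card §Transfer).

Stubs (sorried, registered): `stub_engineReentry`, `stub_irrelevanceContraction`, `stub_ymCertificate`,
`stub_certificateContinuity`, `stub_certifiedClustering`, `stub_packaging`, `stub_transferExtremeHierarchies`.
Composition: `boundedSplitting_of` (sorry-free, pure logic + two archimedean/floor facts) and
`RobustYangMillsHandover_of (hGT : GapTransfer) : RobustYangMillsHandover` (concludes the crux BY NAME; `sorry` only
inside the stubs it calls).

Disproof.lean (cdisprove c1–2) used: §1 `handover_of_perFlavour` shape (per-flavour glue; X₀ idle — §2 says a proof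
must use non-triviality OR prove `QCD`'s body outright: this line does the latter for the ENGINE's regularisation, the
only design compatible with the anonymous witness of X₀, as all three triagers note); §5/§8 (only masses above an
unpinned offset are owed — sharpened here: the offset does NOT bound splittings, whence the scope finding); §9(i)
(η ↛ 0 in `k` at fixed physical scale — honoured: the squeeze is in `M` and `k₀`, never in `k`; the marginal `O(log)`
shift is carried by near-AF windows `IsNearAF`, widened ×2 by `stub_irrelevanceContraction`); §9(ii) (fine bare masses
eventually negative — honoured: coercivity / quark lines appear only at BLOCK scales inside `stub_engineReentry`).
No `_false_without_` theorem exists; landed Negative lemma `Negative/WithoutNontriviality` (junk X₀ minus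
non-triviality) refutes no stub here (no stub consumes X₀).
-/

set_option autoImplicit false

noncomputable section

namespace Summit.QuantumFields.QCD.Cruxes.RobustYangMillsHandover.ThresholdIrrelevanceSqueeze

open scoped ENNReal
open Filter MeasureTheory Topology
open Literature.MathematicalPhysics.QuantumFieldTheory
open Literature.MathematicalPhysics.QuantumLattice (fundamentalRep transport)
open Literature.Probability.LatticeModels (Specification glueWith)
open Summit.QuantumFields.QCD.Theses.HeatSlicedQuarks (ContinuumQCDExists RobustYangMillsHandover)

local notation "𝔾" => Matrix.specialUnitaryGroup (Fin 3) ℂ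

/-- The fundamental representation of `SU(3)` (the tree's Wilson / Dirac representation for QCD). -/
abbrev ρ₃ : 𝔾 →* Matrix (Fin 3) (Fin 3) ℂ := fundamentalRep (Fin 3)

/-! ## §1 Block tori: the canonical axial frame blocking, distances, cells -/

section Geometry

variable {S : ℕ}

/-- Corner (in the fine torus of side `N`) of the block labelled `y` of the block torus of side `S`: per axis the
frame position `⌊j·N/S⌋`, `j = y_i ∈ {0,…,S-1}` — a `[⌊N/S⌋, ⌈N/S⌉]`-frame, so EVERY fine side `N ≥ S` is blocked
(uneven last cells, as in OneCertifiedCube's `[b,2b]`-frames). -/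
def canonCorner (N S : ℕ) (y : Site 4 S) : Site 4 N :=
  fun i => (((y i).val * N / S : ℕ) : ZMod N)

/-- Length (in fine links) of the straight segment carried by the block link `(y, μ)`: `⌊(j+1)N/S⌋ − ⌊jN/S⌋`. -/
def canonLen (N S : ℕ) (y : Site 4 S) (μ : Fin 4) : ℕ :=
  ((y μ).val + 1) * N / S - (y μ).val * N / S

/-- **The canonical axial frame blocking** `canonLink N S : (fine links of the torus of side N) → (block links of the
torus of side S)`: the block link `(y, μ)` carries the straight parallel transporter (tree `transport`) from the corner
of `y` along `μ` to the corner of `y + e_μ` (Bałaban's block link variable in the axial gauge, CMP 95 (1984)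
(1.4)–(1.6), on a product frame). Composition of the scale-`b` frame blocking `N → L^{k₀}S` with the exact axial
`L^{k₀}`-blocking is again `canonLink N S` (same corners `⌊jN/S⌋`) — used inside `stub_irrelevanceContraction`. -/
def canonLink (N S : ℕ) [NeZero N] (U : GaugeConfig 4 N 𝔾) : GaugeConfig 4 S 𝔾 :=
  fun e => transport U (canonCorner N S e.1) (List.replicate (canonLen N S e.1 e.2) e.2)

/-- `ℓ^∞` distance on the block torus (per axis the cyclic distance `|valMinAbs (x − y)|`). -/
def tdist (x y : Site 4 S) : ℕ :=
  Finset.univ.sup fun i : Fin 4 => ((x i - y i).valMinAbs).natAbs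

variable [NeZero S]

/-- The cells (cubes of side `c` blocks, labelled by their corners, tree `blockCorners`) within `ℓ^∞`-distance
`r` cells of the cell `q`: the cube of `(2r+1)⁴` cells centred at `q` (for `2r+1 ≤ S/c`). -/
def cellBall (c r : ℕ) (q : Site 4 S) : Finset (Site 4 S) :=
  (blockCorners (d := 4) (L := S) c).filter fun q' => tdist q q' ≤ r * c

end Geometry

/-! ## §2 Densities on a block torus: kernels with boundary conditions, expectations, finite-size conditions -/

section Densities

variable {S : ℕ} [NeZero S]

/-- **Conditional (specification) kernel of a density** `dens` (w.r.t. the product Haar measure on the links of the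
block torus): in the finite link set `Λ` with boundary condition `η`, the product Haar measure on `Λ` glued with `η`
off `Λ` (tree `glueWith`, as in `ymSpecification` / `torusYM`), weighted by `dens` and normalised (junk `0`/`∞`
normalisers give the zero measure). This is the object a finite-size condition WITH BOUNDARY CONDITIONS speaks about
(triage r1-3: certificates on tori alone do not propagate). -/
def densityKernel (dens : GaugeConfig 4 S 𝔾 → ℝ≥0∞) : Specification (Edge 4 S) 𝔾 :=
  fun Λ η =>
    let m : Measure (GaugeConfig 4 S 𝔾) :=
      ((Measure.pi fun _ : ↥Λ => haarProbability 𝔾).map (glueWith Λ · η)).withDensity dens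
    (m Set.univ)⁻¹ • m

/-- The (unnormalised) torus measure `dens · ∏ dV` of a density. -/
def densMeasure (dens : GaugeConfig 4 S 𝔾 → ℝ≥0∞) : Measure (GaugeConfig 4 S 𝔾) :=
  (torusLinkHaar 4 𝔾 S).withDensity dens

/-- Finite non-zero total mass (so that normalised expectations are not junk). -/
def IsFiniteNonzero (dens : GaugeConfig 4 S 𝔾 → ℝ≥0∞) : Prop :=
  densMeasure dens Set.univ ≠ 0 ∧ densMeasure dens Set.univ ≠ ∞

/-- Normalised expectation `⟨F⟩ = ∫ F dens dV / ∫ dens dV` of a real observable of the block field. -/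
def normExpect (dens : GaugeConfig 4 S 𝔾 → ℝ≥0∞) (F : GaugeConfig 4 S 𝔾 → ℝ) : ℝ :=
  (∫ V, F V ∂(densMeasure dens)) / (densMeasure dens Set.univ).toReal

/-- **The tilted density** `σ(V) e^{-W(V)}` of a blocked Yang–Mills density `σ` by a block-scale perturbation `W`
(the density of the tree's `blockScaleWeight σ W`). -/
def tiltDensity (σ : GaugeConfig 4 S 𝔾 → ℝ≥0∞) (W : QuasiLocalGaugePerturbation 4 S 𝔾 1) :
    GaugeConfig 4 S 𝔾 → ℝ≥0∞ :=
  fun V => σ V * ENNReal.ofReal (Real.exp (-(W.total V)))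

/-- **Range control** of a block-scale perturbation (the (h4) of the repaired `RobustYangMills` 13897; automatic for
Bałaban's CONNECTED localization domains): an activity-carrying polymer has `ℓ^∞`-diameter `< |X|`, so the tree's
weight `e^{κ|X|}` is also a decay in range — without it the W-pair witness (two far blocks, weight `e^{2κ}`) defeats
any quasi-Markov estimate. -/
def IsRangeControlled (W : QuasiLocalGaugePerturbation 4 S 𝔾 1) : Prop :=
  ∀ X : Finset (Site 4 S), (∃ V, W.act X V ≠ 0) → ∀ y ∈ X, ∀ y' ∈ X, tdist y y' + 1 ≤ X.card

/-- **Uniform exponential clustering of a density at cell scale `c`** with constants `(κ, C₀)`: covariances of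
`[-1,1]`-valued measurable cylinder observables supported on the links of cell sets `D_F`, `D_G` at mutual cell
distance `≥ d` are `≤ C₀ |D_F| |D_G| e^{-κ d}`. -/
def DensityClustering (dens : GaugeConfig 4 S 𝔾 → ℝ≥0∞) (c : ℕ) (κ C₀ : ℝ) : Prop :=
  ∀ (F G : GaugeConfig 4 S 𝔾 → ℝ) (DF DG : Finset (Site 4 S)) (d : ℕ),
    Measurable F → Measurable G → (∀ V, |F V| ≤ 1) → (∀ V, |G V| ≤ 1) →
    DF ⊆ blockCorners (d := 4) (L := S) c → DG ⊆ blockCorners (d := 4) (L := S) c →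
    DependsOn F (↑(polymerEdges c DF) : Set (Edge 4 S)) → DependsOn G (↑(polymerEdges c DG) : Set (Edge 4 S)) →
    (∀ x ∈ DF, ∀ y ∈ DG, d * c ≤ tdist x y) →
      |normExpect dens (fun V => F V * G V) - normExpect dens F * normExpect dens G| ≤
        C₀ * DF.card * DG.card * Real.exp (-(κ * d))

/-- **TV mixing condition** (Dobrushin–Shlosman finite-size condition in total variation, window `n`, threshold `ε`,
cells of side `c` blocks — the block-torus twin of the condition inside OneCertifiedCube.CrossoverCertificate /
FiniteSizeCriterion 8895): for every cell `q`, every cell-union `Y` inside the cube of `(4n+1)⁴` cells centred at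
`q` and containing `q`, every two boundary conditions AGREEING on the links of that cube, and every `[0,1]`-valued
measurable function of the links of the central cell, the two kernel expectations in region `Y` differ by `≤ ε`. -/
def TVMixing (dens : GaugeConfig 4 S 𝔾 → ℝ≥0∞) (c n : ℕ) (ε : ℝ) : Prop :=
  ∀ q ∈ blockCorners (d := 4) (L := S) c, ∀ Y : Finset (Site 4 S), Y ⊆ cellBall c (2 * n) q → q ∈ Y →
    ∀ η η' : GaugeConfig 4 S 𝔾, (∀ e ∈ polymerEdges c (cellBall c (2 * n) q), η e = η' e) →
      ∀ f : GaugeConfig 4 S 𝔾 → ℝ, Measurable f → DependsOn f (↑(polymerEdges c {q}) : Set (Edge 4 S)) →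
        (∀ V, 0 ≤ f V ∧ f V ≤ 1) →
          |(∫ V, f V ∂(densityKernel dens (polymerEdges c Y) η)) -
              ∫ V, f V ∂(densityKernel dens (polymerEdges c Y) η')| ≤ ε

/-- **Decaying quasi-Markov condition** (approximate Markov property of the kernels at cell range, with GEOMETRIC
decay in the collar width `w` — what replaces "finite range" for a blocked effective action with `e^{-κ d(X)}`
tails, Bałaban CMP 119 (2.42)): boundary conditions agreeing on the cube of radius `2n + w` cells give kernel
expectations on the cube of radius `2n` that differ by `≤ ε′ ϑ^w` on `[0,1]`-valued functions of that cube. -/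
def TVMarkov (dens : GaugeConfig 4 S 𝔾 → ℝ≥0∞) (c n : ℕ) (ε' ϑ : ℝ) : Prop :=
  ∀ w : ℕ, 1 ≤ w → ∀ q ∈ blockCorners (d := 4) (L := S) c, ∀ η η' : GaugeConfig 4 S 𝔾,
    (∀ e ∈ polymerEdges c (cellBall c (2 * n + w) q), η e = η' e) →
      ∀ f : GaugeConfig 4 S 𝔾 → ℝ, Measurable f →
        DependsOn f (↑(polymerEdges c (cellBall c (2 * n) q)) : Set (Edge 4 S)) → (∀ V, 0 ≤ f V ∧ f V ≤ 1) →
          |(∫ V, f V ∂(densityKernel dens (polymerEdges c (cellBall c (2 * n) q)) η)) -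
              ∫ V, f V ∂(densityKernel dens (polymerEdges c (cellBall c (2 * n) q)) η')| ≤ ε' * ϑ ^ w

end Densities

/-- **Dobrushin–Shlosman threshold** for window `n` and TV parameters `(ε, ε′)`: `(ε + ε′)·M(n) < 1` with
`M(n) = (4n+3)⁴ − (4n+1)⁴` the number of shell cells (OneCertifiedCube's universal threshold, with the quasi-Markov
leak `ε′` added to the mixing coefficient). -/
def DSThreshold (n : ℕ) (ε ε' : ℝ) : Prop :=
  1 ≤ n ∧ 0 ≤ ε ∧ ε ≤ 1 ∧ 0 ≤ ε' ∧ ε' ≤ 1 ∧ (ε + ε') * (((4 * n + 3) ^ 4 - (4 * n + 1) ^ 4 : ℕ) : ℝ) < 1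

/-! ## §3 Blocked Yang–Mills, formats of a blocked theory, near-AF sequences, block scales -/

section Formats

variable {N S : ℕ} [NeZero N] [NeZero S]

variable (N S) in
/-- **`σ` is the blocked density of lattice `SU(3)` Yang–Mills at fine inverse coupling `β′`** through the canonical
frame blocking `canonLink N S`: `(canonLink)_* (e^{-β′ S_W} ∏ dU) = σ ∏ dV` (the tree's `IsBlockingOf` for this
blocking; Bałaban CMP 119 (0.1)). -/
def IsBlockedYM (β' : ℝ) (σ : GaugeConfig 4 S 𝔾 → ℝ≥0∞) : Prop :=
  Measurable σ ∧
    ((torusLinkHaar 4 𝔾 N).withDensity (perturbedWilsonDensity ρ₃ β' 0)).map (canonLink N S) =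
      (torusLinkHaar 4 𝔾 S).withDensity σ

variable (N S) in
/-- **Bałaban format of a fine theory at block side `S`** (output of `stub_engineReentry`, input of
`stub_irrelevanceContraction`): the fine expectation functional `E` (for QCD: `qcdFineExpect`, fermions integrated,
signed weight), read on observables of the BLOCK field `canonLink N S`, IS the normalised expectation of blocked
Yang–Mills at the matched coupling `β′` tilted by a block-scale perturbation `W` whose activities are analytic with
weighted norm `≤ η` on the last-scale small-field domains `smallFieldDomain ρ₃ 1 r εsf` (tree `HasAnalyticNormLE`),
have large-field floor `η` (tree `HasLargeFieldFloor`: suppression of rough block fields is free, lowering the action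
costs `≤ η`-weighted), and are range-controlled. The identity for ALL bounded measurable `F` forces the blocked
(signed) QCD weight to be the POSITIVE measure `σ e^{-W} dV` — fibre positivity at the block scale is part of the
claim (rao-blackwell-sign). [cite: Balaban1988Convergent, p. 259 (2.25)–(2.28), p. 261 (2.42), p. 264 (2.49)] -/
def BalabanFormatAt (E : (GaugeConfig 4 N 𝔾 → ℝ) → ℂ) (β' r εsf κ η : ℝ) : Prop :=
  ∃ (σ : GaugeConfig 4 S 𝔾 → ℝ≥0∞) (W : QuasiLocalGaugePerturbation 4 S 𝔾 1),
    IsBlockedYM N S β' σ ∧ W.HasAnalyticNormLE ρ₃ (smallFieldDomain ρ₃ 1 r εsf) κ η ∧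
      W.HasLargeFieldFloor κ η ∧ IsRangeControlled W ∧ IsFiniteNonzero (tiltDensity σ W) ∧
        ∀ F : GaugeConfig 4 S 𝔾 → ℝ, Measurable F → (∀ V, |F V| ≤ 1) →
          E (F ∘ canonLink N S) = ((normExpect (tiltDensity σ W) F : ℝ) : ℂ)

variable (N S) in
/-- **Sup format at block side `S`** (output of `stub_irrelevanceContraction`, consumed by the certificate chain):
as `BalabanFormatAt` but with the TWO-SIDED weighted sup norm `‖W‖_{1,κ} ≤ ε` over ALL block fields (tree `NormLE`),
range control, and the expectation identity for EVERY version `σ` of the blocked Yang–Mills density (blocked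
densities are determined only a.e.; the identity and the finiteness of the tilted mass do not see the version, and
the certificate stub picks the version whose kernels it certifies). -/
def SupFormatAt (E : (GaugeConfig 4 N 𝔾 → ℝ) → ℂ) (β'' κ ε : ℝ) : Prop :=
  ∃ W : QuasiLocalGaugePerturbation 4 S 𝔾 1, W.NormLE κ ε ∧ IsRangeControlled W ∧
    (∃ σ : GaugeConfig 4 S 𝔾 → ℝ≥0∞, IsBlockedYM N S β'' σ) ∧
      ∀ σ : GaugeConfig 4 S 𝔾 → ℝ≥0∞, IsBlockedYM N S β'' σ →
        Measurable (tiltDensity σ W) ∧ IsFiniteNonzero (tiltDensity σ W) ∧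
          ∀ F : GaugeConfig 4 S 𝔾 → ℝ, Measurable F → (∀ V, |F V| ≤ 1) →
            E (F ∘ canonLink N S) = ((normExpect (tiltDensity σ W) F : ℝ) : ℂ)

variable (N S) in
/-- **Block clustering of a fine theory** read through `canonLink N S` at cell scale `c` (the hypothesis H1 of
`stub_packaging`; for a density it is `DensityClustering`). -/
def BlockClustering (E : (GaugeConfig 4 N 𝔾 → ℝ) → ℂ) (c : ℕ) (κ C₀ : ℝ) : Prop :=
  ∀ (F G : GaugeConfig 4 S 𝔾 → ℝ) (DF DG : Finset (Site 4 S)) (d : ℕ),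
    Measurable F → Measurable G → (∀ V, |F V| ≤ 1) → (∀ V, |G V| ≤ 1) →
    DF ⊆ blockCorners (d := 4) (L := S) c → DG ⊆ blockCorners (d := 4) (L := S) c →
    DependsOn F (↑(polymerEdges c DF) : Set (Edge 4 S)) → DependsOn G (↑(polymerEdges c DG) : Set (Edge 4 S)) →
    (∀ x ∈ DF, ∀ y ∈ DG, d * c ≤ tdist x y) →
      ‖E ((fun V => F V * G V) ∘ canonLink N S) - E (F ∘ canonLink N S) * E (G ∘ canonLink N S)‖ ≤
        C₀ * DF.card * DG.card * Real.exp (-(κ * d))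

variable (N) in
/-- **Lattice symmetry of a fine theory** on the torus of side `N`: the expectation functional is invariant under all
torus translations (tree `torusConfigShift`), the axis permutations (`permuteConfig`) and the time reflection
(`GaugeConfig.timeReflect`) — the hyperoctahedral group `⋉` translations. Hypothesis of `stub_irrelevanceContraction`
(without it an anisotropic or position-dependent MARGINAL part of `W` survives every RG step and is not absorbed by
one coupling `β″`: the W-aniso / W-marg traps that refuted RobustYangMills 8881); exact for torus lattice QCD with
periodic Wilson fermions (clause (v) of `stub_engineReentry`). -/
def IsLatticeSymmetric (E : (GaugeConfig 4 N 𝔾 → ℝ) → ℂ) : Prop :=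
  (∀ (v : Site 4 N) (g : GaugeConfig 4 N 𝔾 → ℝ), E (fun U => g (torusConfigShift v U)) = E g) ∧
    (∀ (π : Equiv.Perm (Fin 4)) (g : GaugeConfig 4 N 𝔾 → ℝ), E (fun U => g (permuteConfig π U)) = E g) ∧
      ∀ g : GaugeConfig 4 N 𝔾 → ℝ, E (fun U => g (GaugeConfig.timeReflect U)) = E g

end Formats

/-- **Near-asymptotic-freedom window**: the inverse bare couplings `β k` are eventually within any `δ > 0` of the
two-loop `N_f = 0` profile `afBeta 0 Λ′ (a k)` for SOME `Λ′ ∈ [Λ₁, Λ₂]` (floating Λ in a compact window — the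
honest form of β-universality a matched sequence needs, Disproof §9(i)(a); exact AF with `Λ′` is the case
`Λ₁ = Λ₂`). -/
def IsNearAF (a β : ℕ → ℝ) (Λ₁ Λ₂ : ℝ) : Prop :=
  ∀ δ : ℝ, 0 < δ → ∀ᶠ k in atTop, ∃ Λ' ∈ Set.Icc Λ₁ Λ₂, |β k - afBeta 0 Λ' (a k)| ≤ δ

/-- **Block-scale sequence at physical scale `ℓ`**: block factors `b k` with `b k · a k ∈ [ℓ/2, ℓ]` eventually
(canonical choice `⌊ℓ / a k⌋₊`, `blockScaleSeq_floor`; stable under `· * P`, `BlockScaleSeq.mul`). -/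
def BlockScaleSeq (a : ℕ → ℝ) (b : ℕ → ℕ) (ℓ : ℝ) : Prop :=
  ∀ᶠ k in atTop, ℓ / 2 ≤ (b k : ℝ) * a k ∧ (b k : ℝ) * a k ≤ ℓ

/-! ## §4 QCD-side currencies -/

section QCDSide

/-- **Fine lattice-QCD expectation of a gauge observable** `g` on the torus of side `N` at inverse coupling `β` and
bare masses `mq` (fermions integrated with their SIGNED determinant: tree `qcdTorusExpect` on the scalar Grassmann
element `g(U)·1`); junk `0` at `N = 0`. -/
def qcdFineExpect (Nf N : ℕ) (β : ℝ) (mq : Fin Nf → ℝ) (g : GaugeConfig 4 N 𝔾 → ℝ) : ℂ :=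
  if h : N = 0 then 0 else
    haveI : NeZero N := ⟨h⟩
    qcdTorusExpect β N mq fun U => algebraMap ℂ (FermiAlg Nf N) ((g U : ℝ) : ℂ)

/-- **Observable re-entry (quark lines) at block scale `b′`** with physical quark-line rate `δq` — clause (iv) of
`stub_engineReentry`: for every pair of gauge-invariant local lattice-QCD observables `A, B` (Wilson loops, mesons,
baryons: tree `QCDLatticeObservable`) there is `C` such that, eventually in `k`, on every torus `2S+1 ≥ 2L_k+1`
read through `canonLink (2S+1) S′` (cells in `[b′_k, 2b′_k)`), and for every time separation `n ≤ S`, the connected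
correlator of `A` and `τ_{n e₀} B` at the scheme's couplings and bare masses equals `s ×` the covariance of two
`[-1,1]`-valued block-cylinder functionals supported on `ϱ`-balls (`ϱ = ϱ(n)`, growing like `n/(16 b′_k)`) around two
blocks, every pair of blocks of the two balls being `≥ n/(4b′_k) − 1` apart, up to a remainder `C e^{-δq a_k n}`
collecting (a) connected heavy quark lines of physical length `a_k n` at block mass `≫ 1`, (b) the truncation of the
block representatives `F_A = E[⟨A⟩_F | V]` to the balls (tails `e^{-c·(block mass)·ϱ}`), (c) the conditional
(fluctuation-field) covariance below the block scale (range `≈ ℓ′`). -/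
def ObservableReentry (Nf : ℕ) (reg : QCDRegularisation Nf) (m : Fin Nf → ℝ) (b' : ℕ → ℕ) (δq : ℝ) : Prop :=
  ∀ (R R' : ℕ) (A : QCDLatticeObservable Nf R) (B : QCDLatticeObservable Nf R'), ∃ s C : ℝ,
    ∀ᶠ k in atTop, ∀ S : ℕ, reg.L k ≤ S → ∀ (S' : ℕ) [NeZero S'],
      b' k * S' ≤ 2 * S + 1 → 2 * S + 1 < 2 * (b' k * S') → ∀ n : ℕ, n ≤ S →
        ∃ (ϱ : ℕ) (F G : GaugeConfig 4 S' 𝔾 → ℝ) (q₁ q₂ : Site 4 S'),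
          Measurable F ∧ Measurable G ∧ (∀ V, |F V| ≤ 1) ∧ (∀ V, |G V| ≤ 1) ∧
          DependsOn F (↑(polymerEdges 1 (cellBall 1 ϱ q₁)) : Set (Edge 4 S')) ∧
          DependsOn G (↑(polymerEdges 1 (cellBall 1 ϱ q₂)) : Set (Edge 4 S')) ∧
          (∀ x ∈ cellBall 1 ϱ q₁, ∀ y ∈ cellBall 1 ϱ q₂, (n : ℝ) ≤ 4 * (b' k : ℝ) * (tdist x y + 1)) ∧
          ‖qcdLatticeConnectedCorr (reg.β k) (2 * S + 1) (fun fl => (reg.scheme m 0 0).mq fl k) A B n -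
              (s : ℂ) * (qcdFineExpect Nf (2 * S + 1) (reg.β k) (fun fl => (reg.scheme m 0 0).mq fl k)
                    ((fun V => F V * G V) ∘ canonLink (2 * S + 1) S') -
                  qcdFineExpect Nf (2 * S + 1) (reg.β k) (fun fl => (reg.scheme m 0 0).mq fl k)
                      (F ∘ canonLink (2 * S + 1) S') *
                    qcdFineExpect Nf (2 * S + 1) (reg.β k) (fun fl => (reg.scheme m 0 0).mq fl k)
                      (G ∘ canonLink (2 * S + 1) S'))‖ ≤
            C * Real.exp (-(δq * (reg.a k * n)))

/-- **QCD with `N_f` flavours, BOUNDED SPLITTINGS** — the honest conclusion of every heavy-threshold handover: ONE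
mass-independent regularisation with `HasMassScaling` such that for every splitting bound `σ ≥ 1` there is a
threshold `M₀(σ)` above which every mass tuple with all ratios `m_f/m_g ≤ σ` has the body of `QCDOf N_f`
(`IsQCDAlong`, non-trivial non-Gaussian glue, non-decoupled flavour-changing pseudoscalars, one `Δ > 0` gapping `T`
and the lattice scheme). Strictly weaker than `QCDOf N_f` (which has ONE `M₀` for all `σ`): the residue is the
extreme-hierarchy family, where `N_f − 1` flavours are light relative to the induced scale (module docstring). -/
def QCDOfBoundedSplitting (Nf : ℕ) : Prop :=
  ∃ reg : QCDRegularisation Nf, reg.HasMassScaling ∧ ∀ spl : ℝ, 1 ≤ spl → ∃ M₀ : ℝ, 0 ≤ M₀ ∧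
    ∀ m : Fin Nf → ℝ, (∀ f, M₀ < m f) → (∀ f g, m f ≤ spl * m g) →
      ∃ (z shift : QCDField Nf → ℕ → ℝ) (T : OSData (QCDField Nf) 4),
        IsQCDAlong (reg.scheme m z shift) T ∧ T.IsNontrivial QCDField.glue ∧ T.IsNonGaussian QCDField.glue ∧
          (∀ f g : Fin Nf, f ≠ g → T.IsNontrivial (QCDField.pseudoRe f g)) ∧
            ∃ Δ > 0, T.HasMassGap Δ ∧ (reg.scheme m z shift).HasLatticeMassGap Δ

end QCDSide

/-! ## §5 The stub statements -/

section Statements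

/-- **RE — engine re-entry** (statement of `stub_engineReentry`; the deliverable of the route's engine
InterleavedHeatSliceFlow 8891 + `low-mode-quarantine` + `rao-blackwell-sign`, run to a block scale `ℓ` below the
quark scale; XL, open). For `N_f ∈ {2,3}` ONE mass-independent regularisation `reg` (its own `a_k, β_k, L_k,
m_crit(k), Z_m(k)`, `HasMassScaling`) such that:
(ii) [shared with every line: the X₀-content for THIS `reg`] above some `M₁`, continuum limits with the three
  non-triviality clauses exist;
(Λq) every mass tuple above `M₁` has a matched pure-gauge scale `Λq m > 0` (one loop:
  `Λ^{1−2N_f/33} ∏_f m_f^{2/33}`, CouplingMatching 8797 split-mass form);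
(iii) HANDOVER FORMAT: for every splitting bound `spl`, all Bałaban domain parameters `(r, εsf)`, every target norm
  `η > 0` and every sufficiently small RELATIVE handover scale `lam` (physical `ℓ = lam / Λq m`; `g²(ℓ) → 0`), above a
  threshold `M₂(spl, r, εsf, κ₀, η, lam)` every `spl`-bounded tuple has a matched coupling sequence `βeff`, near-AF
  in the window `[Λq/2, 2Λq]`, such that along every block-scale sequence `b` at scale `ℓ`, eventually in `k`, on
  EVERY fine torus `N` with `S₁` blocks per axis (`b_k S₁ ≤ N < 2 b_k S₁`), lattice QCD at `(β_k, m_f(k))` read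
  through `canonLink N S₁` is blocked YM at `βeff_k` tilted by a `W` in Bałaban format with norm `η` (heavy-quark
  remainder `O(N_f (ℓ min m)⁻²) +` flavoured-history deviation `O(g²(ℓ))`, both `→ 0`; large fields: floor only);
(iv) OBSERVABLE RE-ENTRY `ObservableReentry` at every relative scale `lam′` above a threshold `M₃(spl, lam′)`, with a
  quark-line / fluctuation rate `δq(spl, lam′) > 0`;
(v) exact LATTICE SYMMETRY of torus QCD expectations (translations, axis permutations, time reflection; provable now).
Why plausible: Appelquist–Carazzone / Symanzik power counting for the remainder (dimension ≥ 6 after the β-shift: the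
only P-, C-even dimension-4 invariant is `tr F²`, no rank-5 hypercubic invariant — triage r1-1/2/3 checked),
Bałaban's small-field analyticity for `log det` of a coercive BLOCK Dirac operator (mass `ℓ·m_f ≫ 1` in block
units), Disproof §9(ii) honoured (block-level coercivity only). Leans on: 8871, 8872, 8891 (route),
`WilsonFermionBlockAveraging`, `BlockScaleEffectivePerturbation`, 8797. [cite: Balaban1988Convergent, Thm 1 and §2]
[cite: AppelquistCarazzone1975] [cite: BalabanOcarrollSchor1989] -/
def EngineReentry : Prop :=
  ∀ Nf : ℕ, Nf = 2 ∨ Nf = 3 →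
    ∃ reg : QCDRegularisation Nf, reg.HasMassScaling ∧
    ∃ M₁ : ℝ, 0 ≤ M₁ ∧
      (∀ m : Fin Nf → ℝ, (∀ f, M₁ < m f) →
        ∃ (z shift : QCDField Nf → ℕ → ℝ) (T : OSData (QCDField Nf) 4),
          IsQCDAlong (reg.scheme m z shift) T ∧ T.IsNontrivial QCDField.glue ∧ T.IsNonGaussian QCDField.glue ∧
            ∀ f g : Fin Nf, f ≠ g → T.IsNontrivial (QCDField.pseudoRe f g)) ∧
    (∀ (m : Fin Nf → ℝ) (k N : ℕ) [NeZero N],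
        IsLatticeSymmetric N (qcdFineExpect Nf N (reg.β k) fun fl => (reg.scheme m 0 0).mq fl k)) ∧
    ∃ Λq : (Fin Nf → ℝ) → ℝ, (∀ m : Fin Nf → ℝ, (∀ f, M₁ < m f) → 0 < Λq m) ∧
      (∀ spl : ℝ, 1 ≤ spl → ∀ (r εsf κ₀ η : ℝ), 0 < r → 0 < εsf → 0 ≤ κ₀ → 0 < η →
        ∃ lam₀ : ℝ, 0 < lam₀ ∧ ∀ lam : ℝ, 0 < lam → lam ≤ lam₀ → ∃ M₂ : ℝ, M₁ ≤ M₂ ∧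
          ∀ m : Fin Nf → ℝ, (∀ f, M₂ < m f) → (∀ f g, m f ≤ spl * m g) →
            ∃ βeff : ℕ → ℝ, IsNearAF reg.a βeff (Λq m / 2) (2 * Λq m) ∧
              ∀ b : ℕ → ℕ, BlockScaleSeq reg.a b (lam / Λq m) →
                ∀ᶠ k in atTop, ∀ (N S₁ : ℕ) [NeZero N] [NeZero S₁], b k * S₁ ≤ N → N < 2 * (b k * S₁) →
                  BalabanFormatAt N S₁ (qcdFineExpect Nf N (reg.β k) fun fl => (reg.scheme m 0 0).mq fl k)
                    (βeff k) r εsf κ₀ η) ∧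
      (∀ spl : ℝ, 1 ≤ spl → ∀ lam' : ℝ, 0 < lam' → ∃ δq : ℝ, 0 < δq ∧ ∃ M₃ : ℝ, M₁ ≤ M₃ ∧
          ∀ m : Fin Nf → ℝ, (∀ f, M₃ < m f) → (∀ f g, m f ≤ spl * m g) →
            ∀ b' : ℕ → ℕ, BlockScaleSeq reg.a b' (lam' / Λq m) → ObservableReentry Nf reg m b' δq)

/-- **IC — irrelevance contraction / large-field transport** (statement of `stub_irrelevanceContraction`; the card's
load-bearing NEW stub, pure gauge, L/XL, inside Bałaban's inductive domain): there are an RG base `L ≥ 2`, domain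
parameters `(r, εsf)`, an input-norm ceiling `η₀`, a decay rate `κ > 0` and a weak-coupling constant `c_w` such that
for every target `ε > 0` some depth `k₁` suffices: whenever a fine theory `E` on tori `N`, along near-AF couplings
`β′` in `[Λ₁, Λ₂]` and a block-scale sequence `b` at scale `ℓ` with `ℓ L^{k₀} Λ₂ ≤ c_w` (the FINAL scale is still
weak coupling — triage r1-2's consistency condition), is eventually in Bałaban format with norm `η ≤ η₀` at block side
`L^{k₀} S′`, then `k₀ ≥ k₁` further exact axial `L`-blockings put it in SUP format at block side `S′` (frame scale
`b·L^{k₀}`) with `‖W′‖_{1,κ} ≤ ε`, relative to blocked YM at a RE-MATCHED near-AF sequence `β″` in the doubled window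
`[Λ₁/2, 2Λ₂]` (the marginal `O(η)` part of `W` and of the flow is absorbed in `β″`, Disproof §9(i); W-marg trap of
8881 avoided by the floating window). Mechanism / why plausibly true: the small-field part of an irrelevant
(dimension ≥ 6) remainder contracts like `L^{-2k₀}`; large-field leftovers of the intermediate scales re-enter
Bałaban's stream as constants + marginal shifts + local terms carrying `e^{-c p(g_j)²}`; both vanish as `k₀ → ∞` at
fixed final scale (quantitative conjecture: `‖W′‖ ≤ C(η L^{-2k₀} + e^{-c p(g(ℓ))²})` — only the `∀ε ∃k₁` form is
asserted, the refutable exponent claims live in the line card). This is where the line can die (card, triage). Leans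
on: `BalabanUVStability4` (named fact), CMP 119 Thm 1 / CMP 122 (large fields), YM-route ParabolicTrajectory
(attraction to the renormalised trajectory). [cite: Balaban1988Convergent, Thm 1, (2.42), (2.49)]
[cite: Balaban1989LargeFieldII, Thm 1] -/
def IrrelevanceContraction : Prop :=
  ∃ (L : ℕ) (r εsf η₀ κ₀ κ cw : ℝ), 2 ≤ L ∧ 0 < r ∧ 0 < εsf ∧ 0 < η₀ ∧ 0 ≤ κ₀ ∧ 0 < κ ∧ 0 < cw ∧
    ∀ ε : ℝ, 0 < ε → ∃ k₁ : ℕ, ∀ k₀ : ℕ, k₁ ≤ k₀ →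
      ∀ (a : ℕ → ℝ), (∀ k, 0 < a k) → Tendsto a atTop (𝓝 0) →
      ∀ (Λ₁ Λ₂ ℓ : ℝ), 0 < Λ₁ → Λ₁ ≤ Λ₂ → 0 < ℓ → ℓ * (L : ℝ) ^ k₀ * Λ₂ ≤ cw →
      ∀ β' : ℕ → ℝ, IsNearAF a β' Λ₁ Λ₂ →
      ∀ b : ℕ → ℕ, BlockScaleSeq a b ℓ →
      ∀ η : ℝ, 0 < η → η ≤ η₀ →
      ∀ E : ℕ → (N : ℕ) → (GaugeConfig 4 N 𝔾 → ℝ) → ℂ,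
        (∀ (k N : ℕ) [NeZero N], IsLatticeSymmetric N (E k N)) →
        (∀ᶠ k in atTop, ∀ (N S' : ℕ) [NeZero N] [NeZero S'] [NeZero (L ^ k₀ * S')],
            b k * (L ^ k₀ * S') ≤ N → N < 2 * (b k * (L ^ k₀ * S')) →
              BalabanFormatAt N (L ^ k₀ * S') (E k N) (β' k) r εsf κ₀ η) →
        ∃ β'' : ℕ → ℝ, IsNearAF a β'' (Λ₁ / 2) (2 * Λ₂) ∧
          ∀ᶠ k in atTop, ∀ (N S' : ℕ) [NeZero N] [NeZero S'],
            b k * L ^ k₀ * S' ≤ N → N < 2 * (b k * L ^ k₀ * S') →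
              SupFormatAt N S' (E k N) (β'' k) κ ε

/-- **YC — the Yang–Mills input in CERTIFICATE form** (statement of `stub_ymCertificate`; YM-Millennium strength
incl. β-universality — the declared conditional input of this conditional-flavour crux; strictly weaker than
`RobustYangMills` 13897 (no action-robustness clause, no OS clause) and the very deliverable the YM-side routes
OneCertifiedCube 8893/8895, FemtoStepScaling, ParabolicTrajectory.LatticeGapOnTrajectory are staffed to produce):
SCALE-FREE — for every window ratio and every dimensionless certificate scale `cdim` there are a cell size `c`, a
window `n`, TV parameters `(ε, ε′, ϑ)` and a MARGIN `μ > 0` with `DSThreshold n (ε+μ) (ε′+μ)` such that for every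
`Λ₁ > 0`, all scaling data, every near-AF coupling sequence in `[Λ₁, ratio·Λ₁]` and every block-scale sequence at
physical scale `cdim/Λ₁`, eventually in `k`, on every fine torus SOME VERSION of the blocked YM density (cells of
physical side `≈ c·cdim/Λ₁`, window of `(4n+1)⁴` cells, boundary conditions on its links) satisfies the TV mixing
condition with `ε` and the decaying quasi-Markov condition with `(ε′, ϑ)` — i.e. with margin `μ` to spare in both
(a version is needed: blocked densities are a.e. objects, kernels read them pointwise on glued fibres). Why it might
fail: TV at the crossover needs k-uniform smallness of boundary influence at physical distance `2n·c·cdim/Λ₁` sup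
over rough boundary data (OneCertifiedCube why-fail; orbit-kantorovich Disproof: marginal at tree level); at small
`cdim` (forced by IC's weak-coupling constraint) the window `n` must grow like `(1/cdim) log(1/cdim)`.
[cite: DobrushinShlosman1985] [cite: JaffeWitten2000, §5] [cite: Balaban1988Convergent, (2.42)] -/
def YMCertificate : Prop :=
  ∀ (ratio cdim : ℝ), 1 ≤ ratio → 0 < cdim →
    ∃ (c n : ℕ) (ε ε' ϑ μ : ℝ), 1 ≤ c ∧ 0 < μ ∧ 0 ≤ ε ∧ 0 ≤ ε' ∧ 0 ≤ ϑ ∧ ϑ < 1 ∧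
      DSThreshold n (ε + μ) (ε' + μ) ∧
      ∀ Λ₁ : ℝ, 0 < Λ₁ → ∀ (a : ℕ → ℝ), (∀ k, 0 < a k) → Tendsto a atTop (𝓝 0) →
      ∀ β' : ℕ → ℝ, IsNearAF a β' Λ₁ (ratio * Λ₁) →
      ∀ b' : ℕ → ℕ, BlockScaleSeq a b' (cdim / Λ₁) →
      ∀ᶠ k in atTop, ∀ (N S' : ℕ) [NeZero N] [NeZero S'], b' k * S' ≤ N → N < 2 * (b' k * S') →
        (8 * n + 7) * c ≤ S' → ∃ σ : GaugeConfig 4 S' 𝔾 → ℝ≥0∞, IsBlockedYM N S' (β' k) σ ∧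
          TVMixing σ c n ε ∧ TVMarkov σ c n ε' ϑ

/-- **CONT — certificate continuity** (statement of `stub_certificateContinuity`; the card's FIRST LEMMA in the form
the composition consumes; size S/M, provable now). Tilting a density `σ` by `e^{-W}` with `‖W‖_{1,κ} ≤ δ`,
`κ > 0`, range-controlled, changes the kernel of any cube `Q` of `(4n+1)⁴` cells only through the activities of
polymers MEETING `Q` (the others are constant in the glued variables and cancel), whose total sup is `≤ |Q|·δ`
(`|Q|` in blocks, `≤ (4n+1)⁴c⁴`), and the ones crossing a collar of width `w` cells have `|X| ≥ wc + 1`, total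
`≤ |Q| δ e^{-κ(wc+1)}`; a density ratio in `[e^{-D}, e^{D}]` moves `[0,1]`-expectations by `≤ e^{2D} − 1` (triage
r1-1/2/3: the torus form `2M(e^{2δ} − 1)` checked by hand; junk normalisers `0/∞` give `0 ≤ 0` on both sides). Hence
for every `μ > 0` some `δ(c, n, μ, κ) > 0` transfers `TVMixing … ε ↦ ε + μ` and `TVMarkov … (ε′, ϑ) ↦ (ε′ + μ,
max ϑ e^{-κc})` (`ε, ε′ ≤ 1`). [cite: FriedliVelenik2017, Thm. 5.4 (5.10)] [folklore] -/
def CertificateContinuity : Prop :=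
  ∀ (c n : ℕ) (μ κ : ℝ), 1 ≤ c → 0 < μ → 0 < κ → ∃ δ : ℝ, 0 < δ ∧
    ∀ (S : ℕ) [NeZero S] (σ : GaugeConfig 4 S 𝔾 → ℝ≥0∞) (W : QuasiLocalGaugePerturbation 4 S 𝔾 1) (ε ε' ϑ : ℝ),
      Measurable σ → W.NormLE κ δ → IsRangeControlled W → 0 ≤ ε → ε ≤ 1 → 0 ≤ ε' → ε' ≤ 1 → 0 ≤ ϑ →
        (TVMixing σ c n ε → TVMixing (tiltDensity σ W) c n (ε + μ)) ∧
          (TVMarkov σ c n ε' ϑ → TVMarkov (tiltDensity σ W) c n (ε' + μ) (max ϑ (Real.exp (-(κ * c)))))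

/-- **CG — certified clustering** (statement of `stub_certifiedClustering`; the Dobrushin–Shlosman / Olivieri–Picco
engine on the BLOCK TORUS for an ARBITRARY positive density — the twin of OneCertifiedCube.FiniteSizeCriterion 8895
with the quasi-Markov leak in the threshold; L). For `DSThreshold n ε ε′` and a geometric quasi-Markov ratio
`ϑ < 1` there are `κ′ > 0`, `C₀` (depending on NOTHING else) such that on every block torus of side
`S ≥ (8n+7)c`, every measurable density of finite non-zero mass satisfying `TVMixing … ε` and `TVMarkov … ε′ ϑ` has
`DensityClustering` with `(κ′, C₀)` at cell scale `c`: the comparison iteration `Ψ(N) ≤ (ε + ε′)M(n) Ψ(N − 2n − 1) +`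
(collar leak `ε′ϑ^{w}` with `w ∝ N`) closes because BOTH error sources decay. Why it might fail: for infinite-range
(quasi-local) kernels "finite-size mixing ⇒ exponential decay" is printed only for finite range (DS85/87,
Martinelli–Olivieri) or via graded cluster expansions (Bertini–Cirillo–Olivieri); the geometric collar decay is the
hypothesis that substitutes for finite range. [cite: DobrushinShlosman1985] [cite: DobrushinShlosman1987]
[cite: BertiniCirilloOlivieri2005] -/
def CertifiedClustering : Prop :=
  ∀ (n : ℕ) (ε ε' ϑ : ℝ), DSThreshold n ε ε' → 0 ≤ ϑ → ϑ < 1 → ∃ κ' : ℝ, 0 < κ' ∧ ∃ C₀ : ℝ, 0 ≤ C₀ ∧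
    ∀ (S c : ℕ) [NeZero S], 1 ≤ c → (8 * n + 7) * c ≤ S → ∀ dens : GaugeConfig 4 S 𝔾 → ℝ≥0∞,
      Measurable dens → IsFiniteNonzero dens → TVMixing dens c n ε → TVMarkov dens c n ε' ϑ →
        DensityClustering dens c κ' C₀

/-- **PK — packaging** (statement of `stub_packaging`; M: floors, frames, exponent bookkeeping — OneCertifiedCube's
assembly arithmetic for QCD observables). Along a block-scale sequence `b′` at physical scale `ℓ′`, block clustering
of the fine QCD functional (uniform constants `κ′, C₀` at cell scale `c`, for block tori with `≥ S₀` blocks per axis,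
eventually in `k`, on EVERY fine torus of any side) plus the quark-line re-entry of every observable pair give the
scheme's lattice gap clause `HasLatticeMassGap Δ` with `Δ = min(δq, κ′/(8cℓ′))`-ish: for `2S+1 ≥ 2L_k+1` the block
torus `S′ = ⌊(2S+1)/b′_k⌋` has `≥ S₀` blocks eventually (`a_k L_k → ∞`, `b′_k a_k ≤ ℓ′`), the two `ϱ`-balls are
`≥ n/(2b′_k) − 2ϱ − 2` blocks apart, and `e^{-κ′ d} ≤ C e^{-κ′ a_k n/(4cℓ′)}`. Plausibly true as typed (pure
bookkeeping; both hypotheses are in lattice-QCD currency). [cite: JaffeWitten2000, §5] [cite: OsterwalderSeiler1978, §2] -/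
def Packaging : Prop :=
  ∀ (Nf : ℕ) (reg : QCDRegularisation Nf) (m : Fin Nf → ℝ) (ℓ' : ℝ) (b' : ℕ → ℕ) (c S₀ : ℕ) (κ' C₀ δq : ℝ),
    0 < ℓ' → 1 ≤ c → 0 < κ' → 0 ≤ C₀ → 0 < δq → BlockScaleSeq reg.a b' ℓ' →
    (∀ᶠ k in atTop, ∀ (N S' : ℕ) [NeZero N] [NeZero S'], b' k * S' ≤ N → N < 2 * (b' k * S') → S₀ ≤ S' →
        BlockClustering N S' (qcdFineExpect Nf N (reg.β k) fun fl => (reg.scheme m 0 0).mq fl k) c κ' C₀) →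
    ObservableReentry Nf reg m b' δq →
      ∃ Δ : ℝ, 0 < Δ ∧ (reg.scheme m 0 0).HasLatticeMassGap Δ

end Statements

/-! ## §6 The stubs (sorried, registered by `ledger skeleton check`) -/

/-- **Stub RE** — engine re-entry (`EngineReentry`, see its docstring). XL, open (contains the engine's continuum
existence for its own regularisation, clause (ii), exactly as every line on this crux must — Disproof §1/§2,
triage cross-cutting note 1). -/
theorem stub_engineReentry : EngineReentry := by
  sorry

/-- **Stub IC** — irrelevance contraction with large-field transport (`IrrelevanceContraction`). L/XL; the
mechanism's hardest and most informative stub (card: "the place this card can die"). -/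
theorem stub_irrelevanceContraction : IrrelevanceContraction := by
  sorry

/-- **Stub YC** — the Yang–Mills certificate (`YMCertificate`). Open problem (YM-side named input, certificate
form, scale-free, with boundary conditions — triage r1-2/3 sharpenings applied). -/
theorem stub_ymCertificate : YMCertificate := by
  sorry

/-- **Stub CONT** — certificate continuity (`CertificateContinuity`). S/M, provable now (density ratios in
`[e^{-D}, e^{D}]`; the card's first lemma). -/
theorem stub_certificateContinuity : CertificateContinuity := by
  sorry

/-- **Stub CG** — certified clustering on the block torus (`CertifiedClustering`). L (DS comparison iteration with
decaying collar leak). -/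
theorem stub_certifiedClustering : CertifiedClustering := by
  sorry

/-- **Stub PK** — packaging to the lattice gap clause (`Packaging`). M (bookkeeping). -/
theorem stub_packaging : Packaging := by
  sorry

/-- **Stub TR — transfer over extreme hierarchies** (the card's `Transfer: C⁺ ⇒ crux`, reduced by the sorry-free
`boundedSplitting_of` to its HONEST RESIDUE). SCOPE CLOSURE, NOT MECHANISM: bounded-splitting QCD for `N_f = 2, 3`
implies `QCDOf 2`, `QCDOf 3`. The residue is the extreme-hierarchy family `(m,…,m,X)`, `X/m → ∞` above a common
offset, on which the lighter flavours are light relative to the induced scale `Λ_eff ∝ X^{2/(33−2(N_f−1))·(…)}`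
(module docstring): its content is `(N_f − 1)`-flavour QCD with light quarks at all mass ratios (for `N_f = 3`: two
light flavours — `QCDOf 2` at threshold `0`, harder than the conjunct), reachable only by flavour peeling with a
ROBUST lower-flavour input, not by any Yang–Mills handover. Difficulty: open-problem, foreign to this line; every
heavy-threshold idea on this crux needs it verbatim. RECOMMENDED (line card §Transfer): restate the crux to conclude
`QCDOfBoundedSplitting 2 ∧ QCDOfBoundedSplitting 3` and file this residue as its own crux. [folklore] -/
theorem stub_transferExtremeHierarchies :
    (∀ Nf : ℕ, Nf = 2 ∨ Nf = 3 → QCDOfBoundedSplitting Nf) → ∀ Nf : ℕ, Nf = 2 ∨ Nf = 3 → QCDOf Nf := by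
  sorry

/-! ## §7 Glue lemmas (proved) -/

section Glue

/-- `HasLatticeMassGap` is monotone: a lattice gap `Δ'` is a lattice gap `Δ ≤ Δ'` (verbatim from Disproof.lean §6). -/
theorem hasLatticeMassGap_anti {Nf : ℕ} (sch : QCDScheme Nf) {Δ Δ' : ℝ} (hle : Δ ≤ Δ')
    (h : sch.HasLatticeMassGap Δ') : sch.HasLatticeMassGap Δ := by
  intro R R' A B
  obtain ⟨C, hC⟩ := h R R' A B
  refine ⟨C, ?_⟩
  filter_upwards [hC] with k hk S hS n hn
  refine (hk S hS n hn).trans ?_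
  have hC0 : 0 ≤ C := by
    have h1 := (norm_nonneg _).trans (hk S hS n hn)
    exact nonneg_of_mul_nonneg_left h1 (Real.exp_pos _)
  refine mul_le_mul_of_nonneg_left (Real.exp_le_exp.mpr ?_) hC0
  have : 0 ≤ sch.a k * n := mul_nonneg (sch.a_pos k).le (Nat.cast_nonneg n)
  nlinarith

/-- Near-AF windows are invariant under rewriting their end points. -/
theorem IsNearAF.congr {a β : ℕ → ℝ} {Λ₁ Λ₂ Λ₁' Λ₂' : ℝ} (h : IsNearAF a β Λ₁ Λ₂) (h₁ : Λ₁ = Λ₁')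
    (h₂ : Λ₂ = Λ₂') : IsNearAF a β Λ₁' Λ₂' := by
  subst h₁; subst h₂; exact h

/-- Block-scale sequences are invariant under rewriting the scale. -/
theorem BlockScaleSeq.congr {a : ℕ → ℝ} {b : ℕ → ℕ} {ℓ ℓ' : ℝ} (h : BlockScaleSeq a b ℓ) (hℓ : ℓ = ℓ') :
    BlockScaleSeq a b ℓ' := by
  subst hℓ; exact h

/-- **The canonical block-scale sequence** `b k = ⌊ℓ / a k⌋₊` sits at scale `ℓ`: `b k · a k ∈ (ℓ − a k, ℓ]`, hence in
`[ℓ/2, ℓ]` once `a k ≤ ℓ/2`. -/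
theorem blockScaleSeq_floor {a : ℕ → ℝ} (ha : ∀ k, 0 < a k) (ha₀ : Tendsto a atTop (𝓝 0)) {ℓ : ℝ}
    (hℓ : 0 < ℓ) : BlockScaleSeq a (fun k => ⌊ℓ / a k⌋₊) ℓ := by
  have hev : ∀ᶠ k in atTop, a k < ℓ / 2 := ha₀.eventually (gt_mem_nhds (half_pos hℓ))
  filter_upwards [hev] with k hk
  have hak := ha k
  have hdiv : 0 ≤ ℓ / a k := div_nonneg hℓ.le hak.le
  constructor
  · -- lower bound: ⌊ℓ/a⌋₊ > ℓ/a − 1, so ⌊ℓ/a⌋₊ · a > ℓ − a ≥ ℓ/2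
    have h1 : ℓ / a k < (⌊ℓ / a k⌋₊ : ℝ) + 1 := Nat.lt_floor_add_one _
    have h2 : ℓ < ((⌊ℓ / a k⌋₊ : ℝ) + 1) * a k := by
      have := mul_lt_mul_of_pos_right h1 hak
      rwa [div_mul_cancel₀ _ hak.ne'] at this
    nlinarith
  · -- upper bound: ⌊ℓ/a⌋₊ ≤ ℓ/a
    have h1 : (⌊ℓ / a k⌋₊ : ℝ) ≤ ℓ / a k := Nat.floor_le hdiv
    have := mul_le_mul_of_nonneg_right h1 hak.le
    rwa [div_mul_cancel₀ _ hak.ne'] at this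

/-- Multiplying a block-scale sequence by a positive integer `P` multiplies its scale by `P`. -/
theorem BlockScaleSeq.mul {a : ℕ → ℝ} {b : ℕ → ℕ} {ℓ : ℝ} (h : BlockScaleSeq a b ℓ) (P : ℕ) :
    BlockScaleSeq a (fun k => b k * P) (ℓ * P) := by
  filter_upwards [h] with k hk
  have hP : (0 : ℝ) ≤ P := Nat.cast_nonneg P
  obtain ⟨h1, h2⟩ := hk
  constructor
  · have := mul_le_mul_of_nonneg_right h1 hP
    push_cast
    nlinarith
  · have := mul_le_mul_of_nonneg_right h2 hP
    push_cast
    nlinarith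

/-- A depth `k₀` beyond any prescribed `k₁` at which `cw / (2 L^{k₀})` is below any prescribed `lam₀ > 0`. -/
theorem exists_depth {L : ℕ} (hL : 2 ≤ L) {cw lam₀ : ℝ} (hlam₀ : 0 < lam₀) (k₁ : ℕ) :
    ∃ k₀ : ℕ, k₁ ≤ k₀ ∧ cw / (2 * (L : ℝ) ^ k₀) ≤ lam₀ := by
  have hL1 : (1 : ℝ) < L := by exact_mod_cast (lt_of_lt_of_le one_lt_two hL)
  obtain ⟨n, hn⟩ := pow_unbounded_of_one_lt (cw / (2 * lam₀)) hL1
  refine ⟨max k₁ n, le_max_left _ _, ?_⟩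
  have hLpos : (0 : ℝ) < L := lt_trans zero_lt_one hL1
  have hpow : (L : ℝ) ^ n ≤ (L : ℝ) ^ max k₁ n := pow_le_pow_right₀ hL1.le (le_max_right _ _)
  have hpos : (0 : ℝ) < 2 * (L : ℝ) ^ max k₁ n := by positivity
  rw [div_le_iff₀ hpos]
  have h1 : cw < (L : ℝ) ^ n * (2 * lam₀) := (div_lt_iff₀ (by positivity)).1 hn
  have h2 : (L : ℝ) ^ n * (2 * lam₀) ≤ (L : ℝ) ^ max k₁ n * (2 * lam₀) :=
    mul_le_mul_of_nonneg_right hpow (by positivity)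
  calc cw ≤ (L : ℝ) ^ max k₁ n * (2 * lam₀) := (h1.trans_le h2).le
    _ = lam₀ * (2 * (L : ℝ) ^ max k₁ n) := by ring

/-- **Block clustering of a blocked theory from its sup-format identity and the clustering of the tilted density**
(the only place where complex QCD expectations meet real block expectations: three rewrites and a norm cast). -/
theorem blockClustering_of_identity {N S : ℕ} [NeZero N] [NeZero S] {E : (GaugeConfig 4 N 𝔾 → ℝ) → ℂ}
    {dens : GaugeConfig 4 S 𝔾 → ℝ≥0∞} {c : ℕ} {κ C₀ : ℝ}
    (hid : ∀ F : GaugeConfig 4 S 𝔾 → ℝ, Measurable F → (∀ V, |F V| ≤ 1) →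
      E (F ∘ canonLink N S) = ((normExpect dens F : ℝ) : ℂ))
    (hclu : DensityClustering dens c κ C₀) : BlockClustering N S E c κ C₀ := by
  intro F G DF DG d hF hG hF1 hG1 hDF hDG hdF hdG hsep
  have hFG : Measurable (fun V => F V * G V) := hF.mul hG
  have hFG1 : ∀ V, |F V * G V| ≤ 1 := fun V => by
    rw [abs_mul]
    exact mul_le_one₀ (hF1 V) (abs_nonneg _) (hG1 V)
  rw [hid _ hFG hFG1, hid F hF hF1, hid G hG hG1, ← Complex.ofReal_mul, ← Complex.ofReal_sub,
    Complex.norm_real, Real.norm_eq_abs]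
  exact hclu F G DF DG d hF hG hF1 hG1 hDF hDG hdF hdG hsep

end Glue

/-! ## §8 The composition (kernel-checked; `sorry` only inside the stubs invoked by `RobustYangMillsHandover_of`) -/

/-- **Composition, bounded-splitting form (sorry-free).** From the six mechanism statements and the registered item
`GradientFlowSpecies.GapTransfer` (8923): `QCDOfBoundedSplitting N_f` for `N_f = 2, 3`. Order of choices (all
BEFORE the mass tuple, so the threshold is honest): engine `reg, M₁, Λq`; IC constants `(L, r, εsf, η₀, κ₀, κ, cw)`;
YC at ratio `16` and `cdim = cw/8`; CONT tolerance `δ(c, n, μ, κ)`; IC depth `k₁(δ)`; CG constants for the tilted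
parameters `(ε+μ, ε′+μ, max ϑ e^{-κc})`; then per splitting bound: RE's `lam₀`, a depth `k₀ ≥ k₁` with
`lam := cw/(2L^{k₀}) ≤ lam₀`, thresholds `M₂(lam)`, `δq`, `M₃(cw/2)`, `M₀ := max M₂ M₃`. Per tuple: handover format at
`b = ⌊lam/(Λq a_k)⌋₊` → IC (window `[Λq/2, 2Λq]`, final scale `cw/(2Λq)`, check `ℓ L^{k₀}·2Λq = cw`) → YC for the
blocked YM at `β″` in `[Λq/4, 4Λq]` → CONT → CG → block clustering of QCD (identity) → PK → lattice gap `Δ`;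
existence data from RE (ii); `GapTransfer` gives `T.HasMassGap (Δ/2)`; monotonicity. -/
theorem boundedSplitting_of (hRE : EngineReentry) (hIC : IrrelevanceContraction) (hYC : YMCertificate)
    (hCT : CertificateContinuity) (hCG : CertifiedClustering) (hPK : Packaging)
    (hGT : Summit.QuantumFields.QCD.Theses.GradientFlowSpecies.GapTransfer) :
    ∀ Nf : ℕ, Nf = 2 ∨ Nf = 3 → QCDOfBoundedSplitting Nf := by
  intro Nf hNf
  obtain ⟨reg, hMS, M₁, hM₁, hexist, hsym, Λq, hΛq, hformat, hreentry⟩ := hRE Nf hNf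
  obtain ⟨L, r, εsf, η₀, κ₀, κ, cw, hL, hr, hεsf, hη₀, hκ₀, hκ, hcw, hIC'⟩ := hIC
  -- universal constants: YM certificate at window ratio 16 and dimensionless scale cw/8, continuity tolerance,
  -- contraction depth, clustering constants for the tilted parameters
  obtain ⟨c, n, ε, ε', ϑ, μ, hc, hμ, hε, hε', hϑ0, hϑ1, hDS, hYC'⟩ :=
    hYC 16 (cw / 8) (by norm_num) (by positivity)
  have hDS' := hDS
  unfold DSThreshold at hDS'
  obtain ⟨-, -, hε1μ, -, hε1μ', -⟩ := hDS'
  have hε1 : ε ≤ 1 := by linarith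
  have hε1' : ε' ≤ 1 := by linarith
  obtain ⟨δ, hδ, hCT'⟩ := hCT c n μ κ hc hμ hκ
  obtain ⟨k₁, hk₁⟩ := hIC' δ hδ
  have hc0 : (0 : ℝ) < c := by exact_mod_cast (lt_of_lt_of_le zero_lt_one hc)
  have hϑ'0 : 0 ≤ max ϑ (Real.exp (-(κ * c))) := le_trans hϑ0 (le_max_left _ _)
  have hϑ'1 : max ϑ (Real.exp (-(κ * c))) < 1 :=
    max_lt hϑ1 (Real.exp_lt_one_iff.2 (by nlinarith [mul_pos hκ hc0]))
  obtain ⟨κ', hκ', C₀, hC₀, hCG'⟩ := hCG n (ε + μ) (ε' + μ) (max ϑ (Real.exp (-(κ * c)))) hDS hϑ'0 hϑ'1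
  have hLpos : (0 : ℝ) < L := by exact_mod_cast (lt_of_lt_of_le zero_lt_two hL)
  refine ⟨reg, hMS, fun spl hspl => ?_⟩
  -- thresholds for this splitting bound (chosen BEFORE the mass tuple)
  obtain ⟨lam₀, hlam₀, hfmt⟩ := hformat spl hspl r εsf κ₀ η₀ hr hεsf hκ₀ hη₀
  obtain ⟨k₀, hk₀₁, hk₀lam⟩ := exists_depth hL (cw := cw) hlam₀ k₁
  have hLk : (0 : ℝ) < (L : ℝ) ^ k₀ := pow_pos hLpos k₀
  set lam : ℝ := cw / (2 * (L : ℝ) ^ k₀) with hlam_def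
  have hlam : 0 < lam := by positivity
  obtain ⟨M₂, hM₁₂, hfmt'⟩ := hfmt lam hlam hk₀lam
  obtain ⟨δq, hδq, M₃, hM₁₃, hre'⟩ := hreentry spl hspl (cw / 2) (by positivity)
  refine ⟨max M₂ M₃, le_trans hM₁ (le_trans hM₁₂ (le_max_left _ _)), fun m hm hsplit => ?_⟩
  -- the mass tuple
  have hm₂ : ∀ f, M₂ < m f := fun f => lt_of_le_of_lt (le_max_left _ _) (hm f)
  have hm₃ : ∀ f, M₃ < m f := fun f => lt_of_le_of_lt (le_max_right _ _) (hm f)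
  have hm₁ : ∀ f, M₁ < m f := fun f => lt_of_le_of_lt hM₁₂ (hm₂ f)
  have hΛ : 0 < Λq m := hΛq m hm₁
  have hΛne : Λq m ≠ 0 := hΛ.ne'
  have hLkne : (L : ℝ) ^ k₀ ≠ 0 := hLk.ne'
  obtain ⟨βeff, hAF, hfmt''⟩ := hfmt' m hm₂ hsplit
  -- (1) handover format along the canonical block-scale sequence at physical scale lam / Λq
  have hb : BlockScaleSeq reg.a (fun k => ⌊lam / Λq m / reg.a k⌋₊) (lam / Λq m) :=
    blockScaleSeq_floor reg.a_pos reg.tendsto_a (div_pos hlam hΛ)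
  have hBF := hfmt'' _ hb
  -- (2) irrelevance contraction: window [Λq/2, 2Λq], handover scale lam/Λq, final scale (lam/Λq)·L^k₀ = cw/(2Λq)
  have hscale : lam / Λq m * (L : ℝ) ^ k₀ * (2 * Λq m) ≤ cw := by
    have h : lam / Λq m * (L : ℝ) ^ k₀ * (2 * Λq m) = cw := by
      rw [hlam_def]; field_simp
    exact h.le
  obtain ⟨β'', hAF'', hSF⟩ := hk₁ k₀ hk₀₁ reg.a reg.a_pos reg.tendsto_a (Λq m / 2) (2 * Λq m) (lam / Λq m)
      (by positivity) (by linarith) (div_pos hlam hΛ) hscale βeff hAF _ hb η₀ hη₀ le_rfl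
      (fun k N => qcdFineExpect Nf N (reg.β k) fun fl => (reg.scheme m 0 0).mq fl k)
      (fun k N _ => hsym m k N)
      (by
        filter_upwards [hBF] with k hk N S' _ _ _ h1 h2
        exact hk N (L ^ k₀ * S') h1 h2)
  -- (3) the YM certificate for the blocked densities at β'' in the window [Λq/4, 4Λq], scale cw/(2Λq)
  have hb'0 := hb.mul (L ^ k₀)
  have hcast : ((L ^ k₀ : ℕ) : ℝ) = (L : ℝ) ^ k₀ := by push_cast; ring
  have hb'1 : BlockScaleSeq reg.a (fun k => ⌊lam / Λq m / reg.a k⌋₊ * L ^ k₀) (cw / 8 / (Λq m / 4)) :=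
    hb'0.congr (by rw [hcast, hlam_def]; field_simp; ring)
  have hb'2 : BlockScaleSeq reg.a (fun k => ⌊lam / Λq m / reg.a k⌋₊ * L ^ k₀) (cw / 2 / Λq m) :=
    hb'0.congr (by rw [hcast, hlam_def]; field_simp)
  have hAF4 : IsNearAF reg.a β'' (Λq m / 4) (16 * (Λq m / 4)) := hAF''.congr (by ring) (by ring)
  have hTV := hYC' (Λq m / 4) (by positivity) reg.a reg.a_pos reg.tendsto_a β'' hAF4 _ hb'1
  -- (4) continuity + certified clustering + the sup-format identity: block clustering of lattice QCD, eventually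
  have hH1 : ∀ᶠ k in atTop, ∀ (N S' : ℕ) [NeZero N] [NeZero S'],
      ⌊lam / Λq m / reg.a k⌋₊ * L ^ k₀ * S' ≤ N → N < 2 * (⌊lam / Λq m / reg.a k⌋₊ * L ^ k₀ * S') →
        (8 * n + 7) * c ≤ S' →
          BlockClustering N S' (qcdFineExpect Nf N (reg.β k) fun fl => (reg.scheme m 0 0).mq fl k) c κ' C₀ := by
    filter_upwards [hSF, hTV] with k hkS hkT N S' _ _ h1 h2 hS
    obtain ⟨W, hW, hRC, -, hall⟩ := hkS N S' h1 h2
    obtain ⟨σ, hYM, hmix, hmar⟩ := hkT N S' h1 h2 hS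
    obtain ⟨hmeas, hfin, hid⟩ := hall σ hYM
    have hct := hCT' S' σ W ε ε' ϑ hYM.1 hW hRC hε hε1 hε' hε1' hϑ0
    exact blockClustering_of_identity hid
      (hCG' S' c hc hS (tiltDensity σ W) hmeas hfin (hct.1 hmix) (hct.2 hmar))
  -- (5) packaging with the quark-line re-entry: the lattice gap clause for reg.scheme m
  obtain ⟨Δ, hΔ, hgap⟩ := hPK Nf reg m (cw / 2 / Λq m) (fun k => ⌊lam / Λq m / reg.a k⌋₊ * L ^ k₀) c
      ((8 * n + 7) * c) κ' C₀ δq (by positivity) hc hκ' hC₀ hδq hb'2 hH1 (hre' m hm₃ hsplit _ hb'2)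
  -- (6) the engine's continuum data and GapTransfer (8923): both gap clauses at Δ/2
  obtain ⟨z, shift, T, hQ, hN, hG, hP⟩ := hexist m hm₁
  have hL2 : (reg.scheme m z shift).HasLatticeMassGap Δ := hgap
  have hT : T.HasMassGap (Δ / 2) :=
    hGT Nf (reg.scheme m z shift) T Δ (Δ / 2) (half_pos hΔ) (half_lt_self hΔ) hQ hL2
  exact ⟨z, shift, T, hQ, hN, hG, hP, Δ / 2, half_pos hΔ, hT,
    hasLatticeMassGap_anti _ (half_le_self hΔ.le) hL2⟩

/-- **The skeleton theorem**: the crux BY NAME, from the seven registered stubs and the registered item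
`GradientFlowSpecies.GapTransfer` (stmt-QuantumFields-8923 — the continuum half, "existence pays", triage
r1-1/2/3); its only non-whitelisted axiom is the `sorryAx` of the stubs. The antecedent X₀ is idle (Disproof §1:
forced, modulo witness-pinning); per-flavour glue as `Disproof.handover_of_perFlavour`. -/
theorem RobustYangMillsHandover_of
    (hGT : Summit.QuantumFields.QCD.Theses.GradientFlowSpecies.GapTransfer) : RobustYangMillsHandover := by
  intro _hX
  have key := stub_transferExtremeHierarchies
    (boundedSplitting_of stub_engineReentry stub_irrelevanceContraction stub_ymCertificate
      stub_certificateContinuity stub_certifiedClustering stub_packaging hGT)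
  exact ⟨key 2 (Or.inl rfl), key 3 (Or.inr rfl)⟩

end Summit.QuantumFields.QCD.Cruxes.RobustYangMillsHandover.ThresholdIrrelevanceSqueeze

end
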